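import Mathlib
import HarnessLib
import Summits.QuantumFields.YangMills.Theses.GronwallGap
import Summits.QuantumFields.YangMills.Theorems.GronwallGapAnalyticDetourStubTorusPressureLimit
import Summits.QuantumFields.YangMills.Theorems.GronwallGapAnalyticDetourStubTorusPartitionDictionary

/-!
# `PathGapModulus` (stmt-QuantumFields-13946), line `registered`: reading of the certificate `AnP` —
# its existence clause is automatic, its whole content is real-analyticity at `0` (lead c5, cycle 6)

Route `GronwallGap`, sub-problem `YangMills`.  The crux's certificate `AnP v` ("Gateaux-real-analytic torus
pressure at the weight `v`") asks, for every continuous class function `φ`, for a function `p : ℝ → ℝ` such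
that the torus pressures `Pseq (v · e^{tφ}) L` converge to `p t` for EVERY real `t` AND `p` is real-analytic at
`0`.  Since `φ` and `t` are arbitrary, the first clause contains the existence of the thermodynamic limit of the
torus pressure for every continuous positive class weight — which looks like a strong hidden hypothesis.  It is
not: for a compact simple (hence compact metrisable, via its faithful matrix representation) `G` the torus
pressure of EVERY continuous positive single-plaquette weight converges along all torus sides
(`stub_torusPressureLimit`, the `d = 4` case of the Literature theorem
`Literature.MathematicalPhysics.QuantumLattice.tendsto_torusPressure_of_continuous_pos`, Friedli–Velenik
Thm. 3.6, transported to the crux's `withDensity … univ` spelling by `stub_torusPartitionDictionary`).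
Hence, for continuous positive `v`, `AnP v` is EQUIVALENT to the bare analyticity statement
"for every continuous class direction `φ`, `t ↦ lim_L Pseq (v e^{tφ}) L` is real-analytic at `t = 0`"
(`pathGap_anP_iff_analyticAt`).  Consequences recorded for the planners / the `AnalyticDetour` line: to
ESTABLISH the certificate along a path only analyticity at `t = 0` has to be proved, never existence of limits;
to REFUTE the crux at a transition parameter `s*` one needs exactly a direction-wise real-analytic limiting
pressure at `w s*`, nothing about finite volumes (cf. CERTIFICATE-ANALYSIS-c3.md §2: the certificate bounds no
finite-volume susceptibility).
Pure glue of landed theorems; no named facts; no definitions.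
-/

namespace Summit.QuantumFields.YangMills.Theorems

open scoped BigOperators Topology
open MeasureTheory Filter

/-- **`AnP v ↔` direction-wise real-analyticity at `0` of the limiting torus pressure** (for continuous positive
`v` on a compact simple `G`; the crux's `Pseq`/`AnP` preamble verbatim).  (→): limits are unique, so the
crux's `p` is `t ↦ limUnder atTop (Pseq (v e^{tφ}))`.  (←): the limits exist unconditionally by
`stub_torusPressureLimit` + `stub_torusPartitionDictionary` (compact metrisability of `G` from the faithful
representation in `IsCompactSimpleLieGroup`), so `p := t ↦ limUnder …` has the required `Tendsto` property.
[folklore] -/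
theorem pathGap_anP_iff_analyticAt :
    ∀ (G : Type) [Group G] [TopologicalSpace G] [IsTopologicalGroup G] [CompactSpace G],
      Literature.MathematicalPhysics.QuantumFieldTheory.IsCompactSimpleLieGroup G →
      letI : MeasurableSpace G := borel G; haveI : BorelSpace G := ⟨rfl⟩;
      let Pseq : (G → ℝ) → ℕ → ℝ := fun v L => (((L + 1 : ℕ) : ℝ) ^ 4)⁻¹ * Real.log (((MeasureTheory.Measure.pi fun _ : Literature.MathematicalPhysics.QuantumFieldTheory.Edge 4 (L + 1) => Literature.MathematicalPhysics.QuantumFieldTheory.haarProbability G).withDensity (fun U : Literature.MathematicalPhysics.QuantumFieldTheory.GaugeConfig 4 (L + 1) G => ENNReal.ofReal (Literature.MathematicalPhysics.QuantumLattice.groupHeatKernelWeight (fun _ : ℝ => v) 0 U))) Set.univ).toReal;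
      let AnP : (G → ℝ) → Prop := fun v => ∀ φ : G → ℝ, Continuous φ → (∀ g h : G, φ (h * g * h⁻¹) = φ g) → ∃ p : ℝ → ℝ, (∀ t : ℝ, Filter.Tendsto (fun L : ℕ => Pseq (fun g => v g * Real.exp (t * φ g)) L) Filter.atTop (nhds (p t))) ∧ AnalyticAt ℝ p 0;
      ∀ v : G → ℝ, Continuous v → (∀ g : G, 0 < v g) →
        (AnP v ↔ ∀ φ : G → ℝ, Continuous φ → (∀ g h : G, φ (h * g * h⁻¹) = φ g) →
          AnalyticAt ℝ (fun t : ℝ => limUnder Filter.atTop (fun L : ℕ => Pseq (fun g => v g * Real.exp (t * φ g)) L)) 0) := by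
  intro G _ _ _ _ hG Pseq AnP v hv hpos
  letI : MeasurableSpace G := borel G
  haveI : BorelSpace G := ⟨rfl⟩
  -- `G` is compact metrisable: the faithful representation is a closed embedding into matrices
  obtain ⟨r⟩ := hG.2
  have hemb : Topology.IsClosedEmbedding r.ρ := r.continuous.isClosedEmbedding r.injective
  haveI : T2Space G := hemb.isEmbedding.t2Space
  haveI : SecondCountableTopology (Matrix (Fin r.N) (Fin r.N) ℂ) :=
    inferInstanceAs (SecondCountableTopology (Fin r.N → Fin r.N → ℂ))
  haveI : SecondCountableTopology G := hemb.isEmbedding.secondCountableTopology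
  -- the limit of the torus pressures of `v e^{tφ}` exists for every continuous `φ` and real `t`
  have hlim : ∀ φ : G → ℝ, Continuous φ → ∀ t : ℝ, ∃ P : ℝ,
      Tendsto (fun L : ℕ => Pseq (fun g => v g * Real.exp (t * φ g)) L) atTop (𝓝 P) := by
    intro φ hφ t
    have hvt : Continuous fun g => v g * Real.exp (t * φ g) :=
      hv.mul (Real.continuous_exp.comp (continuous_const.mul hφ))
    have hvtpos : ∀ g : G, 0 < v g * Real.exp (t * φ g) := fun g => mul_pos (hpos g) (Real.exp_pos _)
    obtain ⟨P, hP⟩ := stub_torusPressureLimit G (fun g => v g * Real.exp (t * φ g)) hvt hvtpos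
    refine ⟨P, hP.congr fun L => ?_⟩
    show _ = (((L + 1 : ℕ) : ℝ) ^ 4)⁻¹ * Real.log _
    rw [(stub_torusPartitionDictionary G L (fun g : G => v g * Real.exp (t * φ g)) hvt hvtpos).2]
  constructor
  · intro hAn φ hφ hcl
    obtain ⟨p, hp, hpa⟩ := hAn φ hφ hcl
    have heq : (fun t : ℝ => limUnder atTop (fun L : ℕ => Pseq (fun g => v g * Real.exp (t * φ g)) L)) = p :=
      funext fun t => (hp t).limUnder_eq
    rw [heq]; exact hpa
  · intro hAn φ hφ hcl
    refine ⟨fun t : ℝ => limUnder atTop (fun L : ℕ => Pseq (fun g => v g * Real.exp (t * φ g)) L),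
      fun t => ?_, hAn φ hφ hcl⟩
    exact tendsto_nhds_limUnder (hlim φ hφ t)

end Summit.QuantumFields.YangMills.Theorems
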